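import Summits.ABC.IUTFork.LDHPerPacketReading
import Literature.IUT.LogVolume.InitialThetaDataVolumeInhabited
import Literature.IUT.LogVolume.GenuineRamificationBounds
import Literature.IUT.LogVolume.DifferentEstimatesCorollaries
import Literature.IUT.LogVolume.PadicSubfields
import Literature.IUT.LogVolume.TensorPacketUnramified
import Literature.IUT.LogVolume.LocalDegreeBridge
import HarnessLib

/-!
# The fork at [IUTchIII] Corollary 3.12, L-DH level: the per-prime reading FAILS for the genuine Θ-volume input OF
# INITIAL Θ-DATA at a deep bad prime (no synthetic input)

Record-only file (D-0012) of the abc-iut cell (WAVE-5 prover abc-iut-w5-d157, gen 3); PROOF-ONLY, no definition, no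
`Prop` fact; TAKES NO SIDE on Cor. 3.12. Sequel to this seat's `LDHPerPrimeReading.lean` (p417488) / `LDHPerPacketReading`
(p417638) / `LDHPerPrimeReadingWitness` (p417819): there the PER-PRIME (procession-averaged, `v_ℚ = p`) reading of Dupuy–Hilado
(1.1)/[IUTchIII] Cor. 3.12 — "`−|log(q)|_p ≤ −|log(Θ)|_p`", STRONGER than the printed GLOBAL inequality and implied by
every per-packet reading R0/R2/R3/R4/VolumeTransport at `p` (skeleton XXIV) — FAILS for a genuine-type input
`I : ThetaVolumeInput F₀ K` with ONE place `v₀` of `F₀` over `p` once `ord_{v₀}(q)` exceeds a threshold in `l` and the local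
different / ramification of the GENUINE completion `K_{v̲₀}` (`DHData.not_perPrimeReading_of_ordq_large`); the inhabitant
exhibited there was SYNTHETIC (`ThetaVolumeInput.deepAt`), whence the hedge of HOME/plan/ADJUDICATION-SPEC.md §2 (G1′)
«ARGUED, NOT kernel-checked …: per-packet readings are false in the intended model for initial Θ-data with one deep bad place».

THIS FILE quantifies over abc-iut-L5-t2's INITIAL Θ-DATA `D : InitialThetaData F K F̄ E l Pb` ([IUTchI] Def. 3.1, REAL
structure over an elliptic curve `E_F`) through abc-iut-S2's adapter `ThetaData.volumeInputOf D r` / `IsVolumeInputOf D I`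
(`InitialThetaDataVolume.lean`: pilot data `(j_E, V^bad_mod, l)` OF `D`, section `V̲` OF `D`, ideles in the genuine
completions `K_{v̲}`), inputs which EXIST for every `D` (abc-iut-w5-d209's `ThetaData.exists_isVolumeInputOf`, [IUTchI]
Ex. 3.2 (iv)).
* §1 `ThetaVolumeInput.stepVConst_lt_of_finrank` — for ANY genuine input the `ord(q)`-free Step (v) constant of p417488,
  `((ℓ⋆+3)/2·d(K_{v̲₀}) + 1)·log p + (ℓ⋆+3)/2·(3 + log e(K_{v̲₀}))`, is `< (ℓ⋆+3)/2·(log p + 2·log[K:ℚ] + 3) + log p`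
  (Lenstra `d(K_{v̲₀}) < 1 + v_p([K_{v̲₀}:ℚ_p])` = abc-iut-L5-t15's `differentOrd_lt` at `k₀ = ℚ_p`; `e(K_{v̲₀}) = e(v̲₀|p) ≤
  [K:ℚ]` = abc-iut-S1's `absRamificationIdx_localFieldFamily_eq`; `[K_{v̲₀}:ℚ_p] ≤ [K:ℚ]`); hence
  `…not_perPrimeReading_of_ordq_large_finrank` (threshold in `p, l, [K:ℚ], [F₀:ℚ], ord_{v₀}(q)` only) and — §3 — the CLEAN
  form `…_of_ordq_log_ge`: `17·(log p + 2·log[K:ℚ] + 3) + 7·log p ≤ ord_{v₀}(q)·log p/[F₀:ℚ]` suffices for every `l ≥ 5`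
  (exact constants `6(ℓ⋆+3)(2ℓ⋆+1)/((2ℓ⋆+5)(ℓ⋆−1)) ↘ 6`, `12(2ℓ⋆+1)/((2ℓ⋆+5)(ℓ⋆−1)) ↘ 0`): LOGARITHMIC in `[K:ℚ]`,
  BOUNDED in `l`.
* §2–§3 INITIAL Θ-DATA: `InitialThetaData.not_perPrimeReading_volumeInputOf_of_ordq_large` (sharp local form),
  `…_finrank`, `…_of_finrank_eq_one` / `…_of_j_mem_range` (`j_E ∈ ℚ` ⇒ `F_mod = ℚ`, ONE place over every `p`),
  `…_of_isVolumeInputOf_…`, the per-PACKET consequence `exists_not_perPacketReading_volumeInputOf_…` (a tensor degree `j`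
  over `p` at which R0 fails for `DHData.ofInput`), the non-vacuity pairing `exists_isVolumeInputOf_not_perPrimeReading`, and
  the clean forms `…_of_ordq_log_ge` / `…_of_j_mem_range_of_ordq_log_ge`: with `j_E ∈ ℚ`, ONE bad prime `p` with
  `ord_p(q)·log p ≥ 24·log p + 34·log[K:ℚ] + 51` kills the per-prime (hence every per-packet) reading, EVERY idele datum.

HONEST SCOPE. (i) Universally quantified over initial Θ-data and their idele data; NO initial Θ-data is constructed here and
none with a deep place is claimed to exist ([IUTchIV] Cor. 2.2 (P1)–(P7) material; Def. 3.1 (c) only asks `l ∤ ord_v(q_v)`).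
Whether given initial Θ-data (e.g. those of [IUTchIV] Cor. 2.2, `K ⊇ F(E[l])`) carry a bad prime of local height
`ord_p(q)·log p ≳ 34·log[K:ℚ] + 24·log p + 51` is an arithmetic property of the curve, not supplied here. (ii) ONE place of
`F_mod` over `p` (e.g. `j_E ∈ ℚ`); with several places of different depth the Step (v) slot term competes (abc-iut-S8's
`slotResidue`; skeleton XXVIc `ForkPacketMixed`). (iii) PER-PRIME / PER-PACKET readings only (STRONGER-THAN-PRINT,
ADJUDICATION-SPEC §2 (G1′)); nothing about the printed GLOBAL inequality, `ThetaVolumeInput.Cor312Of`, or the verbatim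
`Cor312.Setting` (A-line, abc-iut-w4-d107's `Thm311.Real.settingDHVol_not_pointwise_of_sharp`). (iv) L-DH level =
Dupuy–Hilado's idele-built datum `DHData.ofInput` in Mochizuki's normalisation (abc-iut-c312-3/c312-d1), every number a DEFINED
Haar log-volume. [cite: Mochizuki2012, IUTchI Def. 3.1 p. 61–62] [cite: Mochizuki2012, IUTchIV Thm. 1.10 Step (v) p. 27–28]
[cite: DupuyHilado2025, §1 (1.1), Thm. 3.10.1] [claim: Mochizuki2012, status: disputed] for every IUT quotation.
typed ≠ proved; instantiated ≠ endorsed.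
-/

noncomputable section

open NumberField IsDedekindDomain
open Literature.IUT.LogVolume Literature.IUT.HodgeTheaters Literature.NumberTheory.NumberFields

namespace Summit.ABC.IUTFork

/-! ## §1 Any genuine input: the Step (v) constant against `[K:ℚ]` -/

namespace ThetaVolumeInput

variable {F₀ K : Type} [Field F₀] [NumberField F₀] [Field K] [NumberField K] [Algebra F₀ K]

/-- `v_p(n)·log p ≤ log n` for `n ≠ 0` (`p^{v_p(n)} ∣ n`). [folklore] -/
theorem padicValNat_mul_log_le (p : ℕ) [hp : Fact p.Prime] {n : ℕ} (hn : n ≠ 0) :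
    (padicValNat p n : ℝ) * Real.log p ≤ Real.log n := by
  have hle : p ^ padicValNat p n ≤ n := Nat.le_of_dvd (Nat.pos_of_ne_zero hn) pow_padicValNat_dvd
  have hle' : ((p : ℝ)) ^ padicValNat p n ≤ n := by exact_mod_cast hle
  have hp0 : (0 : ℝ) < (p : ℝ) ^ padicValNat p n := by
    have : (0 : ℝ) < p := by exact_mod_cast hp.out.pos
    positivity
  rw [← Real.log_pow]
  exact Real.log_le_log hp0 hle'

variable (σ : PlaceSection F₀ K)

/-- `n_{v̲} = [K_{v̲}:ℚ_p] ≤ [K:ℚ]` for the genuine completion at `v̲ = σ.lift v` (`Σ_{w|p} n_w = [K:ℚ]`).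
[cite: NeukirchANT1999, Ch. II Prop. (8.5)] -/
theorem localDeg_lift_le_finrank {p : ℕ} [Fact p.Prime] (v : placesOver F₀ p) :
    localDeg K (σ.lift v.1) ≤ Module.finrank ℚ K := by
  classical
  rw [← sum_localDeg K p]
  exact Finset.single_le_sum (fun w _ => Nat.zero_le _) (σ.lift_mem_placesOver v)

/-- `e(K_{v̲}) ≤ [K:ℚ]` for the genuine completion (`e(K_{v̲}) = e(v̲|p) ≤ [K:ℚ]`).
[cite: NeukirchANT1999, Ch. II Prop. (6.8)] -/
theorem absRamificationIdx_localFieldFamily_le_finrank {p : ℕ} [hp : Fact p.Prime] (v : placesOver F₀ p) :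
    absRamificationIdx p ((σ.localFieldFamily p hp.out).k v) ≤ Module.finrank ℚ K := by
  rw [σ.absRamificationIdx_localFieldFamily_eq v]
  exact ramificationIdx_int_le_finrank_rat (σ.lift v.1)

/-- **Lenstra's bound for the genuine completion**: `d(K_{v̲}) < 1 + v_p(n_{v̲})` (`differentOrd_lt` over `k₀ = ℚ_p`,
`d(ℚ_p) = 0`, `e(ℚ_p) = 1`). [cite: SerreLocalFields1979, Ch. III §6 Prop. 13] -/
theorem differentOrd_localFieldFamily_lt {p : ℕ} [hp : Fact p.Prime] (v : placesOver F₀ p) :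
    differentOrd p ((σ.localFieldFamily p hp.out).k v) < 1 + padicValNat p (localDeg K (σ.lift v.1)) := by
  have h := differentOrd_lt p ℚ_[p] ((σ.localFieldFamily p hp.out).k v)
  rw [differentOrd_eq_zero_of_absRamificationIdx_eq_one p ℚ_[p] (absRamificationIdx_padic p),
    absRamificationIdx_padic, Nat.cast_one, div_one, zero_add] at h
  rw [σ.localFieldFamily_apply p, σ.finrank_localFields_k p v] at h
  rw [σ.localFieldFamily_apply p]
  exact h

/-- **The `ord(q)`-free Step (v) constant of p417488 against `[K:ℚ]`** (any genuine input, any place `v₀` over `p`):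
`((ℓ⋆+3)/2·d(K_{v̲₀}) + 1)·log p + (ℓ⋆+3)/2·(3 + log e(K_{v̲₀})) < (ℓ⋆+3)/2·(log p + 2·log[K:ℚ] + 3) + log p`.
[cite: Mochizuki2012, IUTchIV Thm. 1.10 Step (v) p. 27–28] [cite: SerreLocalFields1979, Ch. III §6 Prop. 13] -/
theorem stepVConst_lt_of_finrank (I : Literature.IUT.LogVolume.ThetaVolumeInput F₀ K) {p : ℕ} [hpi : Fact p.Prime]
    (v₀ : placesOver F₀ p) :
    (((I.X.lstar : ℝ) + 3) / 2 * differentOrd p ((I.σ.localFieldFamily p hpi.out).k v₀) + 1) * Real.log p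
        + ((I.X.lstar : ℝ) + 3) / 2 *
          (3 + Real.log (absRamificationIdx p ((I.σ.localFieldFamily p hpi.out).k v₀))) <
      ((I.X.lstar : ℝ) + 3) / 2 * (Real.log p + 2 * Real.log (Module.finrank ℚ K) + 3) + Real.log p := by
  set c : ℝ := ((I.X.lstar : ℝ) + 3) / 2 with hc
  set d : ℝ := differentOrd p ((I.σ.localFieldFamily p hpi.out).k v₀) with hd
  set e : ℕ := absRamificationIdx p ((I.σ.localFieldFamily p hpi.out).k v₀) with he
  set n : ℕ := localDeg K (I.σ.lift v₀.1) with hn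
  set N : ℕ := Module.finrank ℚ K with hN
  have hc0 : 0 < c := by rw [hc]; positivity
  have hp1 : (1 : ℝ) < p := by exact_mod_cast hpi.out.one_lt
  have hlogp : 0 < Real.log p := Real.log_pos hp1
  have hn0 : n ≠ 0 := by
    rw [hn, localDeg_eq_localDegree]
    exact (localDegree_pos K _).ne'
  have hnN : n ≤ N := localDeg_lift_le_finrank I.σ v₀
  have hN1 : (1 : ℝ) ≤ N := by
    have : 1 ≤ N := le_trans (Nat.one_le_iff_ne_zero.mpr hn0) hnN
    exact_mod_cast this
  have hlogn : Real.log n ≤ Real.log N :=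
    Real.log_le_log (by exact_mod_cast Nat.pos_of_ne_zero hn0) (by exact_mod_cast hnN)
  -- the different
  have hdlt : d < 1 + padicValNat p n := differentOrd_localFieldFamily_lt I.σ v₀
  have hv : (padicValNat p n : ℝ) * Real.log p ≤ Real.log N :=
    (padicValNat_mul_log_le p hn0).trans hlogn
  have hdlog : d * Real.log p < Real.log p + Real.log N := by
    have := mul_lt_mul_of_pos_right hdlt hlogp
    linarith [this]
  -- the ramification index
  have he1 : 1 ≤ e := absRamificationIdx_pos p _
  have heN : e ≤ N := absRamificationIdx_localFieldFamily_le_finrank I.σ v₀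
  have hloge : Real.log e ≤ Real.log N :=
    Real.log_le_log (by exact_mod_cast he1) (by exact_mod_cast heN)
  have h1 : (c * d + 1) * Real.log p < c * (Real.log p + Real.log N) + Real.log p := by
    have := mul_lt_mul_of_pos_left hdlog hc0
    nlinarith [this]
  have h2 : c * (3 + Real.log e) ≤ c * (3 + Real.log N) := by gcongr
  linarith [h1, h2]

/-- **Per-prime reading fails — threshold in `p`, `l`, `[K:ℚ]`, `[F₀:ℚ]`, `ord_{v₀}(q)` only** (any genuine input with ONE
place `v₀ ∈ S` of `F₀` over `p`): `(ℓ⋆+3)/2·(log p + 2·log[K:ℚ] + 3) + log p ≤ (c_l − 1)·(ord_{v₀}(q)/(2l))·log p/[F₀:ℚ]`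
gives `¬ (−|log(q)|_p ≤ −|log(Θ)|_p)`. [cite: Mochizuki2012, IUTchIV Thm. 1.10 Step (v) p. 27–28]
[cite: DupuyHilado2025, §1 (1.1), Thm. 3.10.1] [claim: Mochizuki2012, status: disputed] -/
theorem not_perPrimeReading_of_ordq_large_finrank (I : Literature.IUT.LogVolume.ThetaVolumeInput F₀ K) {p : ℕ}
    [hpi : Fact p.Prime] (hp1 : ∀ v w : placesOver F₀ p, v = w) (v₀ : placesOver F₀ p) (hv₀ : v₀.1 ∈ I.X.S)
    (hdeep : ((I.X.lstar : ℝ) + 3) / 2 * (Real.log p + 2 * Real.log (Module.finrank ℚ K) + 3) + Real.log p ≤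
      ((((I.X.lstar : ℝ) + 1) * (2 * I.X.lstar + 1) / 6) - 1) *
        ((I.X.ordq v₀.1 : ℝ) / (2 * I.X.l) * Real.log p / Module.finrank ℚ F₀)) :
    ¬ I.negAbsLogQLoc p ≤ I.negLogThetaLoc p := by
  refine DHData.not_perPrimeReading_of_ordq_large I hp1 v₀ hv₀ ((stepVConst_lt_of_finrank I v₀).trans_le ?_)
  refine hdeep.trans ?_
  have hcl : 0 ≤ (((I.X.lstar : ℝ) + 1) * (2 * I.X.lstar + 1) / 6) - 1 := by linarith [I.X.one_lt_avgWeight]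
  have hq : 0 ≤ (I.X.ordq v₀.1 : ℝ) / (2 * I.X.l) := by
    have := I.X.ordq_pos hv₀
    positivity
  have hF : 0 ≤ (Module.finrank ℚ F₀ : ℝ) := Nat.cast_nonneg _
  have hlog : Real.log p ≤ logNorm F₀ v₀.1 := by
    rw [logNorm_eq, (mem_placesOver_iff_residueChar v₀.1).mp v₀.2]
    have h1 : (1 : ℝ) ≤ resDeg F₀ v₀.1 := by exact_mod_cast Nat.one_le_iff_ne_zero.mpr (resDeg_ne_zero F₀ v₀.1)
    have hp : 0 ≤ Real.log p := Real.log_natCast_nonneg p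
    nlinarith
  have : (I.X.ordq v₀.1 : ℝ) / (2 * I.X.l) * Real.log p / Module.finrank ℚ F₀ ≤
      (I.X.ordq v₀.1 : ℝ) / (2 * I.X.l) * logNorm F₀ v₀.1 / Module.finrank ℚ F₀ := by
    gcongr
  exact mul_le_mul_of_nonneg_left this hcl

end ThetaVolumeInput

/-! ## §2 Initial Θ-data ([IUTchI] Def. 3.1): the genuine input OF `D` -/

namespace InitialThetaData

variable {F K Fbar : Type} [Field F] [NumberField F] [Field K] [NumberField K] [Algebra F K]
  [Field Fbar] [Algebra F Fbar] [Algebra K Fbar] {E : WeierstrassCurve F} [E.IsElliptic] {l : ℕ}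
  {Pb : BadPlacePredicates K} (D : Literature.IUT.HodgeTheaters.InitialThetaData F K Fbar E l Pb)

/-- **THE PER-PRIME READING FAILS FOR THE GENUINE INPUT OF INITIAL Θ-DATA AT A DEEP BAD PRIME** (sharp local form): for
initial Θ-data `D` ([IUTchI] Def. 3.1), idele data `r` over its genuine completions `K_{v̲}` ([IUTchI] Ex. 3.2 (iv)), a prime
`p` under ONE place `v₀` of `F_mod` with `v₀ ∈ V^bad_mod`: if
`((ℓ⋆+3)/2·d(K_{v̲₀}) + 1)·log p + (ℓ⋆+3)/2·(3 + log e(K_{v̲₀})) < (c_l − 1)·ord_{v₀}(q)·ln N(v₀)/(2l·[F_mod:ℚ])`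
(`ord_{v₀}(q) = −ord_{v₀}(j_E)`), then `¬ (−|log(q)|_p ≤ −|log(Θ)|_p)` for `volumeInputOf D r` — this seat's
`DHData.not_perPrimeReading_of_ordq_large` at `I := volumeInputOf D r` (`I.X = pilotData D`, `I.σ = placeSection D`
definitionally). [cite: Mochizuki2012, IUTchI Def. 3.1 p. 61–62] [cite: Mochizuki2012, IUTchIV Thm. 1.10 Step (v) p. 27–28]
[cite: DupuyHilado2025, §1 (1.1), Thm. 3.10.1] [claim: Mochizuki2012, status: disputed] -/
theorem not_perPrimeReading_volumeInputOf_of_ordq_large (r : ThetaData.IdeleData D) {p : ℕ} [hpi : Fact p.Prime]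
    (hp1 : ∀ v w : placesOver (fieldOfModuli E) p, v = w) (v₀ : placesOver (fieldOfModuli E) p)
    (hv₀ : v₀.1 ∈ ThetaData.badPrimesMod D)
    (hdeep : ((((ThetaData.pilotData D).lstar : ℝ) + 3) / 2 *
          differentOrd p (((ThetaData.placeSection D).localFieldFamily p hpi.out).k v₀) + 1) * Real.log p
        + (((ThetaData.pilotData D).lstar : ℝ) + 3) / 2 *
          (3 + Real.log (absRamificationIdx p (((ThetaData.placeSection D).localFieldFamily p hpi.out).k v₀))) <
      (((((ThetaData.pilotData D).lstar : ℝ) + 1) * (2 * (ThetaData.pilotData D).lstar + 1) / 6) - 1) *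
        (((ThetaData.pilotData D).ordq v₀.1 : ℝ) / (2 * l) * logNorm (fieldOfModuli E) v₀.1 /
          Module.finrank ℚ (fieldOfModuli E))) :
    ¬ (ThetaData.volumeInputOf D r).negAbsLogQLoc p ≤ (ThetaData.volumeInputOf D r).negLogThetaLoc p :=
  DHData.not_perPrimeReading_of_ordq_large (ThetaData.volumeInputOf D r) hp1 v₀ hv₀ hdeep

/-- **The same with the threshold in `p`, `l`, `[K:ℚ]`, `[F_mod:ℚ]`, `ord_{v₀}(q)` only** (printed-shape arithmetic):
`(ℓ⋆+3)/2·(log p + 2·log[K:ℚ] + 3) + log p ≤ (c_l − 1)·(ord_{v₀}(q)/(2l))·log p/[F_mod:ℚ]` at ONE place `v₀ ∈ V^bad_mod`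
of `F_mod` over `p` kills the per-prime reading for `volumeInputOf D r`, EVERY idele datum `r`.
[cite: Mochizuki2012, IUTchI Def. 3.1 p. 61–62] [cite: Mochizuki2012, IUTchIV Thm. 1.10 Step (v) p. 27–28]
[claim: Mochizuki2012, status: disputed] -/
theorem not_perPrimeReading_volumeInputOf_of_ordq_large_finrank (r : ThetaData.IdeleData D) {p : ℕ}
    [hpi : Fact p.Prime] (hp1 : ∀ v w : placesOver (fieldOfModuli E) p, v = w)
    (v₀ : placesOver (fieldOfModuli E) p) (hv₀ : v₀.1 ∈ ThetaData.badPrimesMod D)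
    (hdeep : (((ThetaData.pilotData D).lstar : ℝ) + 3) / 2 *
          (Real.log p + 2 * Real.log (Module.finrank ℚ K) + 3) + Real.log p ≤
      (((((ThetaData.pilotData D).lstar : ℝ) + 1) * (2 * (ThetaData.pilotData D).lstar + 1) / 6) - 1) *
        (((ThetaData.pilotData D).ordq v₀.1 : ℝ) / (2 * l) * Real.log p / Module.finrank ℚ (fieldOfModuli E))) :
    ¬ (ThetaData.volumeInputOf D r).negAbsLogQLoc p ≤ (ThetaData.volumeInputOf D r).negLogThetaLoc p :=
  ThetaVolumeInput.not_perPrimeReading_of_ordq_large_finrank (ThetaData.volumeInputOf D r) hp1 v₀ hv₀ hdeep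

/-- **`j_E ∈ ℚ` (`[F_mod:ℚ] = 1`): no hypothesis on the places over `p` is left** — a degree-one field has ONE place over
every prime (`ValLine.placesOver_subsingleton_of_finrank_eq_one`), so at a bad prime `p` under `v₀ ∈ V^bad_mod` the
per-prime reading for `volumeInputOf D r` fails once `(ℓ⋆+3)/2·(log p + 2·log[K:ℚ] + 3) + log p ≤
(c_l − 1)·(ord_{v₀}(q)/(2l))·log p`. [cite: Mochizuki2012, IUTchI Def. 3.1 p. 61–62]
[cite: Mochizuki2012, IUTchIV Thm. 1.10 Step (v) p. 27–28] [claim: Mochizuki2012, status: disputed] -/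
theorem not_perPrimeReading_volumeInputOf_of_finrank_eq_one (hj : Module.finrank ℚ (fieldOfModuli E) = 1)
    (r : ThetaData.IdeleData D) {p : ℕ} [hpi : Fact p.Prime] (v₀ : placesOver (fieldOfModuli E) p)
    (hv₀ : v₀.1 ∈ ThetaData.badPrimesMod D)
    (hdeep : (((ThetaData.pilotData D).lstar : ℝ) + 3) / 2 *
          (Real.log p + 2 * Real.log (Module.finrank ℚ K) + 3) + Real.log p ≤
      (((((ThetaData.pilotData D).lstar : ℝ) + 1) * (2 * (ThetaData.pilotData D).lstar + 1) / 6) - 1) *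
        (((ThetaData.pilotData D).ordq v₀.1 : ℝ) / (2 * l) * Real.log p)) :
    ¬ (ThetaData.volumeInputOf D r).negAbsLogQLoc p ≤ (ThetaData.volumeInputOf D r).negLogThetaLoc p := by
  refine not_perPrimeReading_volumeInputOf_of_ordq_large_finrank D r
    (ValLine.placesOver_subsingleton_of_finrank_eq_one hj p) v₀ hv₀ ?_
  rwa [hj, Nat.cast_one, div_one]

/-- `j_E ∈ ℚ ⟹ [F_mod:ℚ] = 1` (`F_mod = ℚ(j_E) ⊆ F`, abc-iut-L5-t2's `fieldOfModuli E := ℚ⟮j_E⟯` by design choice).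
[cite: Mochizuki2012, IUTchI Def. 3.1 (b) p. 61] -/
theorem finrank_fieldOfModuli_eq_one_of_j_mem_range (hj : E.j ∈ Set.range (algebraMap ℚ F)) :
    Module.finrank ℚ (fieldOfModuli E) = 1 := by
  rw [IntermediateField.finrank_eq_one_iff, fieldOfModuli, IntermediateField.adjoin_simple_eq_bot_iff,
    IntermediateField.mem_bot]
  exact hj

/-- **`j_E ∈ ℚ`, stated on `j_E`**: for initial Θ-data on a curve with RATIONAL `j`-invariant (so `F_mod = ℚ`), at a bad
prime `p` under `v₀ ∈ V^bad_mod` the per-prime reading for `volumeInputOf D r` fails once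
`(ℓ⋆+3)/2·(log p + 2·log[K:ℚ] + 3) + log p ≤ (c_l − 1)·(ord_{v₀}(q)/(2l))·log p`.
[cite: Mochizuki2012, IUTchI Def. 3.1 p. 61–62] [cite: Mochizuki2012, IUTchIV Thm. 1.10 Step (v) p. 27–28]
[claim: Mochizuki2012, status: disputed] -/
theorem not_perPrimeReading_volumeInputOf_of_j_mem_range (hj : E.j ∈ Set.range (algebraMap ℚ F))
    (r : ThetaData.IdeleData D) {p : ℕ} [hpi : Fact p.Prime] (v₀ : placesOver (fieldOfModuli E) p)
    (hv₀ : v₀.1 ∈ ThetaData.badPrimesMod D)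
    (hdeep : (((ThetaData.pilotData D).lstar : ℝ) + 3) / 2 *
          (Real.log p + 2 * Real.log (Module.finrank ℚ K) + 3) + Real.log p ≤
      (((((ThetaData.pilotData D).lstar : ℝ) + 1) * (2 * (ThetaData.pilotData D).lstar + 1) / 6) - 1) *
        (((ThetaData.pilotData D).ordq v₀.1 : ℝ) / (2 * l) * Real.log p)) :
    ¬ (ThetaData.volumeInputOf D r).negAbsLogQLoc p ≤ (ThetaData.volumeInputOf D r).negLogThetaLoc p :=
  not_perPrimeReading_volumeInputOf_of_finrank_eq_one D (finrank_fieldOfModuli_eq_one_of_j_mem_range hj) r v₀ hv₀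
    hdeep

/-- **`IsVolumeInputOf` form**: the same for EVERY genuine Θ-volume input `I` OF `D` (abc-iut-S2's predicate; every such `I`
is `volumeInputOf D r`, `ThetaData.exists_eq_volumeInputOf`). [cite: Mochizuki2012, IUTchI Def. 3.1 p. 61–62]
[cite: Mochizuki2012, IUTchIV Thm. 1.10 Step (v) p. 27–28] [claim: Mochizuki2012, status: disputed] -/
theorem not_perPrimeReading_of_isVolumeInputOf_of_ordq_large_finrank
    {I : Literature.IUT.LogVolume.ThetaVolumeInput (fieldOfModuli E) K} (hI : ThetaData.IsVolumeInputOf D I) {p : ℕ}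
    [hpi : Fact p.Prime] (hp1 : ∀ v w : placesOver (fieldOfModuli E) p, v = w)
    (v₀ : placesOver (fieldOfModuli E) p) (hv₀ : v₀.1 ∈ ThetaData.badPrimesMod D)
    (hdeep : (((ThetaData.pilotData D).lstar : ℝ) + 3) / 2 *
          (Real.log p + 2 * Real.log (Module.finrank ℚ K) + 3) + Real.log p ≤
      (((((ThetaData.pilotData D).lstar : ℝ) + 1) * (2 * (ThetaData.pilotData D).lstar + 1) / 6) - 1) *
        (((ThetaData.pilotData D).ordq v₀.1 : ℝ) / (2 * l) * Real.log p / Module.finrank ℚ (fieldOfModuli E))) :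
    ¬ I.negAbsLogQLoc p ≤ I.negLogThetaLoc p := by
  obtain ⟨r, rfl⟩ := ThetaData.exists_eq_volumeInputOf D hI
  exact not_perPrimeReading_volumeInputOf_of_ordq_large_finrank D r hp1 v₀ hv₀ hdeep

/-- **Per-PACKET consequence**: under the same threshold there is a tensor degree `j = i+1 ≤ ℓ⋆` over `p` at which the
per-packet reading R0 FAILS for the Dupuy–Hilado datum `DHData.ofInput (volumeInputOf D r)` of the initial Θ-data
(`ln ν̄_{𝔸_p^{⊗ j+1}}(hull U_Θ) < ln ν̄_{𝔸_p^{⊗ j+1}}(O_𝕃(−P_q))`), hence also R2/R3/R4/VolumeTransport at `(j, p)`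
(skeleton XXIV). [cite: DupuyHilado2025, Def. 3.6.3, Thm. 3.10.1] [claim: Mochizuki2012, status: disputed] -/
theorem exists_not_perPacketReading_volumeInputOf_of_ordq_large_finrank (r : ThetaData.IdeleData D) {p : ℕ}
    [hpi : Fact p.Prime] (hp1 : ∀ v w : placesOver (fieldOfModuli E) p, v = w)
    (v₀ : placesOver (fieldOfModuli E) p) (hv₀ : v₀.1 ∈ ThetaData.badPrimesMod D)
    (hdeep : (((ThetaData.pilotData D).lstar : ℝ) + 3) / 2 *
          (Real.log p + 2 * Real.log (Module.finrank ℚ K) + 3) + Real.log p ≤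
      (((((ThetaData.pilotData D).lstar : ℝ) + 1) * (2 * (ThetaData.pilotData D).lstar + 1) / 6) - 1) *
        (((ThetaData.pilotData D).ordq v₀.1 : ℝ) / (2 * l) * Real.log p / Module.finrank ℚ (fieldOfModuli E))) :
    ∃ i : Fin (ThetaData.pilotData D).lstar,
      (DHData.ofInput (ThetaData.volumeInputOf D r)).M.lnνTensorPower p ((i : ℕ) + 1)
          ((DHData.ofInput (ThetaData.volumeInputOf D r)).M.hullUTheta
            (DHData.ofInput (ThetaData.volumeInputOf D r)).ind3) <
        (DHData.ofInput (ThetaData.volumeInputOf D r)).M.lnνTensorPower p ((i : ℕ) + 1)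
          ((DHData.ofInput (ThetaData.volumeInputOf D r)).M.region
            (DHData.ofInput (ThetaData.volumeInputOf D r)).tq) := by
  have h := not_perPrimeReading_volumeInputOf_of_ordq_large_finrank D r hp1 v₀ hv₀ hdeep
  rw [← DHData.lnνLp_regionq_ofInput _ hpi.out, ← DHData.lnνLp_hullUTheta_ofInput _ hpi.out] at h
  exact (DHData.ofInput (ThetaData.volumeInputOf D r)).exists_not_perPacketReading_of_not_perPrimeReading h

/-- **Non-vacuity pairing**: for EVERY collection of initial Θ-data `D` a genuine Θ-volume input OF `D` EXISTS
(abc-iut-w5-d209's `ThetaData.exists_isVolumeInputOf`, [IUTchI] Ex. 3.2 (iv)) — and for it the per-prime reading at a bad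
prime under the threshold above FAILS. No initial Θ-data is constructed here. [cite: Mochizuki2012, IUTchI Def. 3.1 p. 61–62,
Ex. 3.2 (iv) p. 71] [claim: Mochizuki2012, status: disputed] -/
theorem exists_isVolumeInputOf_not_perPrimeReading [IsScalarTower F K Fbar] {p : ℕ} [hpi : Fact p.Prime]
    (hp1 : ∀ v w : placesOver (fieldOfModuli E) p, v = w)
    (v₀ : placesOver (fieldOfModuli E) p) (hv₀ : v₀.1 ∈ ThetaData.badPrimesMod D)
    (hdeep : (((ThetaData.pilotData D).lstar : ℝ) + 3) / 2 *
          (Real.log p + 2 * Real.log (Module.finrank ℚ K) + 3) + Real.log p ≤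
      (((((ThetaData.pilotData D).lstar : ℝ) + 1) * (2 * (ThetaData.pilotData D).lstar + 1) / 6) - 1) *
        (((ThetaData.pilotData D).ordq v₀.1 : ℝ) / (2 * l) * Real.log p / Module.finrank ℚ (fieldOfModuli E))) :
    ∃ I : Literature.IUT.LogVolume.ThetaVolumeInput (fieldOfModuli E) K,
      ThetaData.IsVolumeInputOf D I ∧ ¬ I.negAbsLogQLoc p ≤ I.negLogThetaLoc p := by
  obtain ⟨I, hI⟩ := ThetaData.exists_isVolumeInputOf D
  exact ⟨I, hI, not_perPrimeReading_of_isVolumeInputOf_of_ordq_large_finrank D hI hp1 v₀ hv₀ hdeep⟩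

end InitialThetaData

/-! ## §3 Clean thresholds: `17·(log p + 2·log[K:ℚ] + 3) + 7·log p ≤ ord_{v₀}(q)·log p/[F₀:ℚ]` -/

namespace ThetaVolumeInput

/-- Real core of the clean threshold: `m ≥ 2`, `X, L ≥ 0`, `17X + 7L ≤ Q ⟹ (m+3)/2·X + L ≤ ((m+1)(2m+1)/6 − 1)·Q/(2(2m+1))`
(`22m² + 9m − 103 ≥ 0`, `14m² − 3m − 47 ≥ 0` for `m ≥ 2`). [folklore] -/
theorem threshold_aux {m X L Q : ℝ} (hm : 2 ≤ m) (hX : 0 ≤ X) (hL : 0 ≤ L) (h : 17 * X + 7 * L ≤ Q) :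
    (m + 3) / 2 * X + L ≤ (((m + 1) * (2 * m + 1) / 6) - 1) * (Q / (2 * (2 * m + 1))) := by
  have hm0 : 0 < 2 * (2 * m + 1) := by linarith
  have hX1 := mul_nonneg hX (show 0 ≤ 22 * m ^ 2 + 9 * m - 103 by nlinarith)
  have hL1 := mul_nonneg hL (show 0 ≤ 14 * m ^ 2 - 3 * m - 47 by nlinarith)
  have key : (m + 3) / 2 * X + L ≤ (((m + 1) * (2 * m + 1) / 6) - 1) * ((17 * X + 7 * L) / (2 * (2 * m + 1))) := by
    rw [mul_div_assoc', le_div_iff₀ hm0]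
    nlinarith [hX1, hL1]
  exact key.trans (mul_le_mul_of_nonneg_left (div_le_div_of_nonneg_right h hm0.le) (by nlinarith))

variable {F₀ K : Type} [Field F₀] [NumberField F₀] [Field K] [NumberField K] [Algebra F₀ K]

/-- **Clean threshold (any genuine input, ONE place `v₀ ∈ S` of `F₀` over `p`)**: the per-prime reading fails at `p` once
`17·(log p + 2·log[K:ℚ] + 3) + 7·log p ≤ ord_{v₀}(q)·log p/[F₀:ℚ]` (constants good for every `l ≥ 5`; exact ones
`6(ℓ⋆+3)(2ℓ⋆+1)/((2ℓ⋆+5)(ℓ⋆−1)) ↘ 6`, `12(2ℓ⋆+1)/((2ℓ⋆+5)(ℓ⋆−1)) ↘ 0`: LOGARITHMIC in `[K:ℚ]`, BOUNDED in `l`).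
[cite: Mochizuki2012, IUTchIV Thm. 1.10 Step (v) p. 27–28] [claim: Mochizuki2012, status: disputed] -/
theorem not_perPrimeReading_of_ordq_log_ge (I : Literature.IUT.LogVolume.ThetaVolumeInput F₀ K) {p : ℕ}
    [hpi : Fact p.Prime] (hp1 : ∀ v w : placesOver F₀ p, v = w) (v₀ : placesOver F₀ p) (hv₀ : v₀.1 ∈ I.X.S)
    (hdeep : 17 * (Real.log p + 2 * Real.log (Module.finrank ℚ K) + 3) + 7 * Real.log p ≤
      (I.X.ordq v₀.1 : ℝ) * Real.log p / Module.finrank ℚ F₀) :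
    ¬ I.negAbsLogQLoc p ≤ I.negLogThetaLoc p := by
  refine not_perPrimeReading_of_ordq_large_finrank I hp1 v₀ hv₀ ?_
  have hlogp : 0 ≤ Real.log p := Real.log_natCast_nonneg p
  have hN : 0 ≤ Real.log (Module.finrank ℚ K) := Real.log_natCast_nonneg _
  have hm : (2 : ℝ) ≤ I.X.lstar := by exact_mod_cast I.X.two_le_lstar
  have h := threshold_aux hm (by positivity) hlogp hdeep
  rw [I.X.l_cast]
  convert h using 2
  ring

end ThetaVolumeInput

namespace InitialThetaData

variable {F K Fbar : Type} [Field F] [NumberField F] [Field K] [NumberField K] [Algebra F K]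
  [Field Fbar] [Algebra F Fbar] [Algebra K Fbar] {E : WeierstrassCurve F} [E.IsElliptic] {l : ℕ}
  {Pb : BadPlacePredicates K} (D : Literature.IUT.HodgeTheaters.InitialThetaData F K Fbar E l Pb)

/-- **INITIAL Θ-DATA, clean threshold**: ONE place `v₀ ∈ V^bad_mod` of `F_mod` over `p` and
`17·(log p + 2·log[K:ℚ] + 3) + 7·log p ≤ ord_{v₀}(q)·log p/[F_mod:ℚ]` kill the per-prime reading for `volumeInputOf D r`, EVERY
`r`. [cite: Mochizuki2012, IUTchI Def. 3.1 p. 61–62] [cite: Mochizuki2012, IUTchIV Thm. 1.10 Step (v) p. 27–28]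
[claim: Mochizuki2012, status: disputed] -/
theorem not_perPrimeReading_volumeInputOf_of_ordq_log_ge (r : ThetaData.IdeleData D) {p : ℕ} [hpi : Fact p.Prime]
    (hp1 : ∀ v w : placesOver (fieldOfModuli E) p, v = w) (v₀ : placesOver (fieldOfModuli E) p)
    (hv₀ : v₀.1 ∈ ThetaData.badPrimesMod D)
    (hdeep : 17 * (Real.log p + 2 * Real.log (Module.finrank ℚ K) + 3) + 7 * Real.log p ≤
      ((ThetaData.pilotData D).ordq v₀.1 : ℝ) * Real.log p / Module.finrank ℚ (fieldOfModuli E)) :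
    ¬ (ThetaData.volumeInputOf D r).negAbsLogQLoc p ≤ (ThetaData.volumeInputOf D r).negLogThetaLoc p :=
  ThetaVolumeInput.not_perPrimeReading_of_ordq_log_ge (ThetaData.volumeInputOf D r) hp1 v₀ hv₀ hdeep

/-- **INITIAL Θ-DATA with `j_E ∈ ℚ`, clean threshold**: ONE bad prime `p` (under `v₀ ∈ V^bad_mod`) of local height
`ord_p(q)·log p ≥ 24·log p + 34·log[K:ℚ] + 51` kills the per-prime — hence every per-packet — reading for `volumeInputOf D r`,
EVERY idele datum `r`. [cite: Mochizuki2012, IUTchI Def. 3.1 p. 61–62] [cite: Mochizuki2012, IUTchIV Thm. 1.10 Step (v) p. 27–28]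
[claim: Mochizuki2012, status: disputed] -/
theorem not_perPrimeReading_volumeInputOf_of_j_mem_range_of_ordq_log_ge (hj : E.j ∈ Set.range (algebraMap ℚ F))
    (r : ThetaData.IdeleData D) {p : ℕ} [hpi : Fact p.Prime] (v₀ : placesOver (fieldOfModuli E) p)
    (hv₀ : v₀.1 ∈ ThetaData.badPrimesMod D)
    (hdeep : 24 * Real.log p + 34 * Real.log (Module.finrank ℚ K) + 51 ≤
      ((ThetaData.pilotData D).ordq v₀.1 : ℝ) * Real.log p) :
    ¬ (ThetaData.volumeInputOf D r).negAbsLogQLoc p ≤ (ThetaData.volumeInputOf D r).negLogThetaLoc p := by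
  have hd : Module.finrank ℚ (fieldOfModuli E) = 1 := finrank_fieldOfModuli_eq_one_of_j_mem_range hj
  refine not_perPrimeReading_volumeInputOf_of_ordq_log_ge D r
    (ValLine.placesOver_subsingleton_of_finrank_eq_one hd p) v₀ hv₀ ?_
  rw [hd, Nat.cast_one, div_one]
  linarith

end InitialThetaData

end Summit.ABC.IUTFork

end
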